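import Summits.QuantumFields.YangMills.Theorems.TwistedTraceScaling.Negative.OrthoTubeKineticCross
import Summits.QuantumFields.YangMills.Theorems.LuscherReductionTwistedTraceScalingOrthoTransverseRotation
import Summits.QuantumFields.YangMills.Theorems.LuscherReductionTwistedTraceScalingToronCurl
import HarnessLib

/-!
# R28 — frames for the Coriolis term: on the abelian slow path the ortho chart's kinetic exponent IS a framed product form, with the HALF-ANGLE (spinorial)
# colour frame and axis-transverse stiff data, exactly; it is NOT for the frozen frame (R26) nor for ANY frame that factors through the adjoint image `Ad(u_k)`
# (crux `LuscherReduction.TwistedTraceScaling`, stmt-QuantumFields-20203; standing disprover, cycle 23; vets lane A g12 COARSE-DESIGN §23.7/§23.8 and the bricks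
# `…OrthoTransverseRotation`, `…GaugeActionCovariant`, `…CovGradInjective`, `…SliceEquiv`)

VETTED: §23.7 («R26 AGREED … the LAB-aligned fibre coordinate `w := R_u v` … `Σ|q−q'|² = L³Σ|m−m'|² + Σ|w−w'|²` EXACTLY — no cross term»; model stiff factor
`G_st(v, R_A v')`, `A = u⁻¹u'` per direction; kinetic-core budget `q' > 5/6`) and §23.8 ((N1) orbit meets slice, (N2) `N(U) = N(U*)`, first orders vanish).
FINDING (tightness of R26 and the shape of the repair).  Per link, with `W_x = chartSU2 x`, `α = √(1−|x|²)` and the slow step `diagSU2 ψ = (cos ψ, sin ψ·e₀)`: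
★ `scalarPart_chart_diagSU2_chart_inv`: `(W_x·diagSU2 ψ·W_y⁻¹)₀ = cos ψ·αα' + sin ψ·(α y₀ − α' x₀) + (chargedRot(−ψ) x)·y − (1 − cos ψ)·x₀y₀` — the rotation of the
charged colour plane by the FULL slow angle `ψ` is `Ad(diagSU2(−ψ/2))`, the HALF-ANGLE spinor (polar / Levi-Civita transport on `S³`; `Ad` of the slow link itself turns by `2ψ`).
Hence on the abelian slow path `w_φ = (diagSU2 φ, 1, 1)` of R26 and AXIS-TRANSVERSE stiff data (`v_e·e₀ = 0` on direction-`0` links):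
★★ `timeCoupling_abelian_transverse`: `tc(Ψ(w_φ,v), Ψ(w_φ',v')) = 2Σ_e c_e(φ−φ')·α_eα'_e + 2Σ_e (colourRotate r_φ v)_e·(colourRotate r_φ' v')_e`, `r_φ = (diagSU2(−φ/2), 1, 1)`,
`c_e = cos` on direction `0`, `1` elsewhere — an EXACT framed product form `F(u,u'; |v|², |v'|²) + G(ρ_u v, ρ_u' v')` (lane A's §23.7 shape, in lane A's `colourRotate`).
Against it: ★★★ `not_separable_abelian_transverse` — with the frame FROZEN there are no such `F, G` even on this small family (R26's witness lives in it; this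
sharpens R26's `not_separable`); ★★★ `not_separable_of_frame_period` — nor with ANY slow-dependent frame `ρ_u` (arbitrary self-maps of the fibre) having
`ρ_{w_π} = ρ_{w_0}`, in particular (`not_separable_adjointFrame`, `not_separable_colourRotate_slowLink`) none that factors through the adjoint images `(Ad(u_k))_k`
— every «LAB rotation `R_u` of the slow link», `Ad(u)`, `Ad(u)⁻¹` or any function of them — because `w_π = (−1,1,1)` is central (`Ad(−1) = 1`) while the witness
defect `Δ(φ) = −4ε²(cos φ + sin φ)` has `Δ(π) ≠ Δ(0)`.  So the frame of §23.7 must be SPINORIAL: a function of the `SU(2)`-valued slow link separating `u` from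
`−u` (here `!![1,0,0; 0,u₀,u⃗₀; 0,−u⃗₀,u₀]`, `frame_eq_of_parts`), turning by half of `Ad`'s angle.
READING (no kill; bearing on the record nil — lane A's (3)/(d) is claimed on the kinetic core with the budget `q' > 5/6` of R26 §3, which needs no frame).  For whoever
types the model kernel `K₁(u,u')·G_st(ρ_u v, ρ_u' v')`: (i) along abelian (commuting) slow displacements the half-angle frame removes the Coriolis term EXACTLY on
axis-transverse data; axial components leave the explicit remainders `sin ψ(α y₀ − α' x₀)` (third order, balanced data) and `(1 − cos ψ)x₀y₀` (second order in `ψ`);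
(ii) for NON-commuting slow pairs no frame `u ↦ ρ_u` is exact to first order for all pairs: the only near-identity frame change symmetrising `vᵀ(a₀I + [a⃗×])v'` is the
polar transport `R_â(φ)` (if `S X` is symmetric with `S = diag(1,1,σ)`, `0 < σ < 1`, `X ∈ SO(3)`, then `X = I` or `X² = I`), and polar transports have holonomy around
non-abelian triangles (the Levi-Civita curvature of `S³`; among left-invariant connections `cθ` only `c = 0, 2` are flat, the symmetric one is `c = 1`) — paper remark,
not typed here.  HONEST FRAMING: quaternion algebra on a fixed lattice for a stub of a child of the CONDITIONAL reduction route R2b1 (femto rung); no kernel estimate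
refuted or proved; C4 OPEN; not infinite volume, not a gap, not Clay.

## References
* M. Lüscher, Some analytic results concerning the mass spectrum of Yang–Mills gauge theories on a torus, Nucl. Phys. B219 (1983) 233–261, §3. [Luscher1983]
* T. Bröcker, T. tom Dieck, *Representations of Compact Lie Groups*, Springer GTM 98 (1985), I (1.10). [BrockerTomDieck1985]
-/

set_option autoImplicit false

noncomputable section

open Finset Real
open scoped BigOperators Matrix
open Literature.MathematicalPhysics.QuantumFieldTheory hiding SU2
open Literature.MathematicalPhysics.QuantumLattice

namespace Summit.QuantumFields.YangMills.Theorems.TwistedTraceScaling.Negative.R28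

open Summit.QuantumFields.YangMills.Theorems.FemtoTransferGap Summit.QuantumFields.YangMills.Theorems.FemtoTransferGap.TwoLattice
open Summit.QuantumFields.YangMills.Theorems.FemtoTransferGap.TwoLattice.Toron Summit.QuantumFields.YangMills.Theorems.FemtoTransferGap.TwoLattice.Flat
open Summit.QuantumFields.YangMills.Theorems.FemtoTransferGap.TwoLattice.Cov Summit.QuantumFields.YangMills.Theorems.FemtoTransferGap.TwoLattice.ConstTube
open Summit.QuantumFields.YangMills.Theorems.TwistedTraceScaling.Negative.R26

variable {L : ℕ} [NeZero L]

/-! ## §1 Per-link algebra: the slow step through a stiff pair, exactly; the charged rotation is the half-angle adjoint -/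

omit [NeZero L] in
/-- Two stiff links with no slow step: `(W_x W_y⁻¹)₀ = αα' + x·y`. [cite: BrockerTomDieck1985, I (1.10)] -/
theorem scalarPart_chart_chart_inv {x y : Fin 3 → ℝ} (hx : ∑ a, x a ^ 2 ≤ 1) (hy : ∑ a, y a ^ 2 ≤ 1) :
    scalarPart (chartSU2 x * (chartSU2 y)⁻¹) = √(1 - ∑ a, x a ^ 2) * √(1 - ∑ a, y a ^ 2) + x ⬝ᵥ y := by
  rw [scalarPart_mul, scalarPart_inv, vecPart_inv, scalarPart_chartSU2 hx, vecPart_chartSU2 hx, scalarPart_chartSU2 hy, vecPart_chartSU2 hy,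
    dotProduct_neg]
  ring

omit [NeZero L] in
/-- ★ **THE SLOW STEP THROUGH A STIFF PAIR, EXACTLY**: `(W_x · diagSU2 ψ · W_y⁻¹)₀ = cos ψ·αα' + sin ψ·(α y₀ − α' x₀) + (chargedRot(−ψ) x)·y − (1 − cos ψ)·x₀y₀`
(`α = √(1−|x|²)`, `α' = √(1−|y|²)`; `e₀` = the axis of `diagSU2`).  The bilinear stiff part is the rotation of `x` by the full slow angle about the slow axis, up to the
symmetric axial defect `(1 − cos ψ)x₀y₀`; the `sin ψ` term is linear in the stiff data. [cite: BrockerTomDieck1985, I (1.10)] -/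
theorem scalarPart_chart_diagSU2_chart_inv {x y : Fin 3 → ℝ} (hx : ∑ a, x a ^ 2 ≤ 1) (hy : ∑ a, y a ^ 2 ≤ 1) (ψ : ℝ) :
    scalarPart (chartSU2 x * diagSU2 ψ * (chartSU2 y)⁻¹) =
      Real.cos ψ * (√(1 - ∑ a, x a ^ 2) * √(1 - ∑ a, y a ^ 2)) +
        Real.sin ψ * (√(1 - ∑ a, x a ^ 2) * y 0 - √(1 - ∑ a, y a ^ 2) * x 0) +
        (chargedRot (-ψ) *ᵥ x) ⬝ᵥ y - (1 - Real.cos ψ) * (x 0 * y 0) := by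
  rw [scalarPart_mul, scalarPart_inv, vecPart_inv, scalarPart_mul, vecPart_mul, scalarPart_chartSU2 hx, vecPart_chartSU2 hx,
    scalarPart_chartSU2 hy, vecPart_chartSU2 hy, scalarPart_diagSU2, vecPart_diagSU2]
  simp [dotProduct, Fin.sum_univ_three, cross_apply, chargedRot, Matrix.mulVec, Real.cos_neg, Real.sin_neg, Matrix.vecHead, Matrix.vecTail]
  ring

omit [NeZero L] in
/-- Charged rotations are isometries composing by angle: `(chargedRot a x)·(chargedRot b y) = (chargedRot (a − b) x)·y`. [folklore] -/
theorem chargedRot_mulVec_dot (a b : ℝ) (x y : Fin 3 → ℝ) :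
    (chargedRot a *ᵥ x) ⬝ᵥ (chargedRot b *ᵥ y) = (chargedRot (a - b) *ᵥ x) ⬝ᵥ y := by
  simp [chargedRot, Matrix.mulVec, dotProduct, Fin.sum_univ_three, Real.cos_sub, Real.sin_sub]
  ring

omit [NeZero L] in
/-- ★ **The frame is the HALF-ANGLE adjoint**: `Ad(diagSU2(−φ/2)) = chargedRot(−φ)` — the colour rotation that absorbs the slow step `diagSU2 φ` turns by half of
`Ad(diagSU2 φ) = chargedRot(2φ)`. [cite: BrockerTomDieck1985, I (1.10)] -/
theorem adRot_diagSU2_half (φ : ℝ) : adRot (diagSU2 (-(φ / 2))) = chargedRot (-φ) := by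
  rw [adRot_diagSU2, show 2 * -(φ / 2) = -φ by ring]

omit [NeZero L] in
/-- The frame as a function of the `SU(2)`-valued slow link `u = diagSU2 φ` (it separates `u` from `−u`; it is not a function of `Ad(u)`):
`chargedRot(−φ) = !![1,0,0; 0,u₀,u⃗₀; 0,−u⃗₀,u₀]` with `u₀ = scalarPart u`, `u⃗₀ = (vecPart u)₀`. [folklore] -/
theorem frame_eq_of_parts (φ : ℝ) :
    chargedRot (-φ) = !![1, 0, 0; 0, scalarPart (diagSU2 φ), vecPart (diagSU2 φ) 0; 0, -vecPart (diagSU2 φ) 0, scalarPart (diagSU2 φ)] := by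
  rw [scalarPart_diagSU2, vecPart_diagSU2]
  simp [chargedRot, Real.cos_neg, Real.sin_neg]

omit [NeZero L] in
/-- The half-angle colour frame on the fibre, link by link: rotation by `−φ` of the charged plane on direction-`0` links, identity elsewhere. [folklore] -/
theorem colourRotate_halfAngle_apply (φ : ℝ) (v : Edge 3 L → Fin 3 → ℝ) (e : Edge 3 L) :
    colourRotate L (fun k => if k = 0 then diagSU2 (-(φ / 2)) else 1) v e = if e.2 = 0 then chargedRot (-φ) *ᵥ v e else v e := by
  simp only [colourRotate]
  by_cases hk : e.2 = 0
  · rw [if_pos hk, if_pos hk, adRot_diagSU2_half]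
  · rw [if_neg hk, if_neg hk, adRot_one, Matrix.one_mulVec]

/-! ## §2 ★★ The exact framed product form on the abelian slow path with axis-transverse stiff data -/

/-- The slow steps of the abelian path compose: `W_x·diagSU2 φ·(W_y·diagSU2 φ')⁻¹ = W_x·diagSU2(φ − φ')·W_y⁻¹`. [folklore] -/
theorem chart_diag_mul_inv (x y : Fin 3 → ℝ) (φ φ' : ℝ) :
    chartSU2 x * diagSU2 φ * (chartSU2 y * diagSU2 φ')⁻¹ = chartSU2 x * diagSU2 (φ - φ') * (chartSU2 y)⁻¹ := by
  rw [sub_eq_add_neg, diagSU2_add, diagSU2_neg, mul_inv_rev]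
  simp only [mul_assoc]

/-- ★★ **THE FRAMED PRODUCT FORM IS EXACT ON THE ABELIAN × TRANSVERSE FAMILY.**  On the slow path `w_φ = (diagSU2 φ, 1, 1)` and for capped stiff data with no axial
component on the turning direction (`v_e·e₀ = 0 = v'_e·e₀` when `dir e = 0`):
`tc(Ψ(w_φ,v), Ψ(w_φ',v')) = 2Σ_e c_e(φ−φ')·α_eα'_e + 2Σ_e (colourRotate r_φ v)_e·(colourRotate r_φ' v')_e`, `r_φ = (diagSU2(−φ/2), 1, 1)`, `c_e = cos` on direction `0`, else `1`:
slow factor × profiles, plus a stiff factor of the HALF-ANGLE-framed coordinates only — no Coriolis remainder. [cite: Luscher1983, §3] -/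
theorem timeCoupling_abelian_transverse (φ φ' : ℝ) {v v' : Edge 3 L → Fin 3 → ℝ} (hv : ∀ e, ∑ a, v e a ^ 2 ≤ 1) (hv' : ∀ e, ∑ a, v' e a ^ 2 ≤ 1)
    (ht : ∀ e : Edge 3 L, e.2 = 0 → v e 0 = 0) (ht' : ∀ e : Edge 3 L, e.2 = 0 → v' e 0 = 0) :
    timeCoupling su2Rep (orthoTube L (fun e => if e.2 = 0 then diagSU2 φ else 1) v) (orthoTube L (fun e => if e.2 = 0 then diagSU2 φ' else 1) v') =
      2 * ∑ e : Edge 3 L, (if e.2 = 0 then Real.cos (φ - φ') else 1) * (√(1 - ∑ a, v e a ^ 2) * √(1 - ∑ a, v' e a ^ 2)) +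
      2 * ∑ e : Edge 3 L, colourRotate L (fun k => if k = 0 then diagSU2 (-(φ / 2)) else 1) v e ⬝ᵥ
        colourRotate L (fun k => if k = 0 then diagSU2 (-(φ' / 2)) else 1) v' e := by
  unfold timeCoupling
  rw [Finset.mul_sum, Finset.mul_sum, ← Finset.sum_add_distrib]
  refine Finset.sum_congr rfl fun e _ => ?_
  rw [TubeMax.re_trace_su2Rep, orthoTube_apply, orthoTube_apply, colourRotate_halfAngle_apply, colourRotate_halfAngle_apply]
  by_cases hk : e.2 = 0
  · simp only [hk, if_true]
    rw [chart_diag_mul_inv, scalarPart_chart_diagSU2_chart_inv (hv e) (hv' e), ht e hk, ht' e hk, chargedRot_mulVec_dot,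
      show -φ - -φ' = -(φ - φ') by ring]
    ring
  · simp only [hk, if_false]
    rw [mul_one, mul_one, scalarPart_chart_chart_inv (hv e) (hv' e)]
    ring

/-! ## §3 ★★★ … and for no lesser frame: frozen frames (R26) and all frames factoring through `Ad(u_k)` are refuted on the same family -/

/-- The abelian path starts at `1`. [folklore] -/
theorem path_zero : (fun e : Edge 3 1 => if e.2 = 0 then diagSU2 0 else (1 : SU2)) = (1 : GaugeConfig 3 1 SU2) := by
  funext e
  split_ifs <;> simp [diagSU2_zero]

/-- ★★ **R26's two-link witness lives in the abelian × transverse family** (every `L ≥ 2`, `ε² ≤ 1/4`): `v^A = amp·e₁`, `v^B = amp·e₂` (`amp = ±ε` at `((0,0,0),0)`,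
`((1,0,0),0)`), both capped balanced, equal profiles, no `e₀`-component, and `tc(Ψ(w_φ,v^A),Ψ(1,v^B)) − tc(Ψ(w_φ,v^A),Ψ(1,v^A)) = −4ε²(cos φ + sin φ)`.
[cite: Luscher1983, §3] -/
theorem witness_defect (hL : 2 ≤ L) {ε : ℝ} (hε : ε ^ 2 ≤ 1 / 4) :
    ∃ vA vB : Edge 3 L → Fin 3 → ℝ, vA ∈ capBalancedSet L ∧ vB ∈ capBalancedSet L ∧ (fun e => ∑ a, vB e a ^ 2) = (fun e => ∑ a, vA e a ^ 2) ∧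
      (∀ e : Edge 3 L, e.2 = 0 → vA e 0 = 0) ∧ (∀ e : Edge 3 L, e.2 = 0 → vB e 0 = 0) ∧
      ∀ φ : ℝ, timeCoupling su2Rep (orthoTube L (fun e => if e.2 = 0 then diagSU2 φ else 1) vA) (orthoTube L 1 vB) -
          timeCoupling su2Rep (orthoTube L (fun e => if e.2 = 0 then diagSU2 φ else 1) vA) (orthoTube L 1 vA) =
        -4 * ε ^ 2 * (Real.cos φ + Real.sin φ) := by
  haveI : Fact (1 < L) := ⟨hL⟩
  have hne : (((0 : Site 3 L), (0 : Fin 3)) : Edge 3 L) ≠ ((Pi.single 0 1 : Site 3 L), (0 : Fin 3)) := fun h => by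
    simpa using congrFun (congrArg Prod.fst h) 0
  set e₀ : Edge 3 L := ((0 : Site 3 L), (0 : Fin 3)) with he₀
  set e₁ : Edge 3 L := ((Pi.single 0 1 : Site 3 L), (0 : Fin 3)) with he₁
  set amp : Edge 3 L → ℝ := fun e => if e = e₀ then ε else if e = e₁ then -ε else 0 with hamp
  have amp0 : amp e₀ = ε := by simp [hamp]
  have amp1 : amp e₁ = -ε := by simp [hamp, hne.symm]
  have ampo : ∀ e, e ≠ e₀ → e ≠ e₁ → amp e = 0 := fun e h0 h1 => by simp [hamp, h0, h1]
  have ampsq : ∀ e, amp e ^ 2 ≤ ε ^ 2 := fun e => by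
    by_cases h0 : e = e₀
    · rw [h0, amp0]
    · by_cases h1 : e = e₁
      · rw [h1, amp1, neg_sq]
      · rw [ampo e h0 h1, zero_pow two_ne_zero]; exact sq_nonneg ε
  have ampbal : ∀ k : Fin 3, ∑ x : Site 3 L, amp (x, k) = 0 := fun k => by
    by_cases hk : k = 0
    · subst hk
      rw [Fintype.sum_eq_add (0 : Site 3 L) (Pi.single 0 1 : Site 3 L) (fun h => hne (congrArg (fun x => (x, (0 : Fin 3))) h)) fun x hx =>
          ampo _ (fun h => hx.1 (congrArg Prod.fst h)) (fun h => hx.2 (congrArg Prod.fst h)), amp0, amp1, add_neg_cancel]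
    · exact Finset.sum_eq_zero fun x _ => ampo _ (fun h => hk (congrArg Prod.snd h)) (fun h => hk (congrArg Prod.snd h))
  have mem : ∀ c : Fin 3, (fun e => (Pi.single c (amp e) : Fin 3 → ℝ)) ∈ capBalancedSet L := fun c => by
    refine ⟨(mem_balancedSet L _).2 fun k a => ?_, fun e => ?_⟩
    · by_cases ha : a = c
      · subst ha; simp only [Pi.single_eq_same]; exact ampbal k
      · simp [Pi.single_eq_of_ne ha]
    · show ∑ a, (Pi.single c (amp e) : Fin 3 → ℝ) a ^ 2 ≤ 1 / 4
      rw [sum_single_sq]; exact (ampsq e).trans hε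
  have hε1 : ε ^ 2 ≤ 1 := hε.trans (by norm_num)
  have hε1' : (-ε) ^ 2 ≤ 1 := by rwa [neg_sq]
  obtain ⟨k0, k1⟩ : e₀.2 = 0 ∧ e₁.2 = 0 := ⟨rfl, rfl⟩
  have hΔ : ∀ φ : ℝ, timeCoupling su2Rep (orthoTube L (fun e => if e.2 = 0 then diagSU2 φ else 1) fun e => Pi.single 1 (amp e))
        (orthoTube L 1 fun e => Pi.single 2 (amp e)) -
      timeCoupling su2Rep (orthoTube L (fun e => if e.2 = 0 then diagSU2 φ else 1) fun e => Pi.single 1 (amp e))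
        (orthoTube L 1 fun e => Pi.single 1 (amp e)) = -4 * ε ^ 2 * (Real.cos φ + Real.sin φ) := fun φ => by
    unfold timeCoupling
    rw [← Finset.sum_sub_distrib, Fintype.sum_eq_add e₀ e₁ hne ?_]
    · simp only [orthoTube_apply, TubeMax.re_trace_su2Rep, Pi.one_apply, mul_one, k0, k1, if_true, amp0, amp1,
        scalarPart_link_AB hε1, scalarPart_link_AB hε1', scalarPart_link_AA]
      ring
    · rintro e ⟨h0, h1⟩
      simp only [orthoTube_apply, ampo e h0 h1, Pi.single_zero, sub_self]
  refine ⟨fun e => Pi.single 1 (amp e), fun e => Pi.single 2 (amp e), mem 1, mem 2, ?_, fun e _ => by simp, fun e _ => by simp, hΔ⟩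
  funext e; simp only [sum_single_sq]

/-- ★★★ **NO FRAME WITH `ρ_{w_π} = ρ_{w_0}`**: for ANY slow-dependent self-map `ρ_u` of the stiff fibre with `ρ_{(−1,1,1)} = ρ_{(1,1,1)}` there are no `F, G` with
`tc(Ψ(w_φ,v),Ψ(w_φ',v')) = F(w_φ,w_φ'; (|v_e|²)_e, (|v'_e|²)_e) + G(ρ_{w_φ} v, ρ_{w_φ'} v')` on the abelian × (capped balanced transverse) family, `L ≥ 2` — the central slow
point `w_π` is invisible to such a frame while the witness defect has `Δ(π) = −Δ(0) ≠ 0`. [cite: Luscher1983, §3] -/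
theorem not_separable_of_frame_period (hL : 2 ≤ L) (ρ : GaugeConfig 3 1 SU2 → (Edge 3 L → Fin 3 → ℝ) → (Edge 3 L → Fin 3 → ℝ))
    (hρ : ρ (fun e => if e.2 = 0 then diagSU2 Real.pi else 1) = ρ (fun e => if e.2 = 0 then diagSU2 0 else 1)) :
    ¬ ∃ (F : GaugeConfig 3 1 SU2 → GaugeConfig 3 1 SU2 → (Edge 3 L → ℝ) → (Edge 3 L → ℝ) → ℝ)
        (G : (Edge 3 L → Fin 3 → ℝ) → (Edge 3 L → Fin 3 → ℝ) → ℝ),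
        ∀ (φ φ' : ℝ) (v v' : Edge 3 L → Fin 3 → ℝ), v ∈ capBalancedSet L → v' ∈ capBalancedSet L →
          (∀ e : Edge 3 L, e.2 = 0 → v e 0 = 0) → (∀ e : Edge 3 L, e.2 = 0 → v' e 0 = 0) →
          timeCoupling su2Rep (orthoTube L (fun e => if e.2 = 0 then diagSU2 φ else 1) v) (orthoTube L (fun e => if e.2 = 0 then diagSU2 φ' else 1) v') =
            F (fun e => if e.2 = 0 then diagSU2 φ else 1) (fun e => if e.2 = 0 then diagSU2 φ' else 1) (fun e => ∑ a, v e a ^ 2) (fun e => ∑ a, v' e a ^ 2) +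
              G (ρ (fun e => if e.2 = 0 then diagSU2 φ else 1) v) (ρ (fun e => if e.2 = 0 then diagSU2 φ' else 1) v') := by
  rintro ⟨F, G, h⟩
  obtain ⟨vA, vB, hA, hB, hprof, htA, htB, hΔ⟩ := witness_defect hL (by norm_num : ((1 : ℝ) / 2) ^ 2 ≤ 1 / 4)
  have hAB := fun φ => h φ 0 vA vB hA hB htA htB
  have hAA := fun φ => h φ 0 vA vA hA hA htA htA
  simp only [path_zero] at hAB hAA hΔ hρ
  have key : ∀ φ : ℝ, -4 * ((1 : ℝ) / 2) ^ 2 * (Real.cos φ + Real.sin φ) =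
      G (ρ (fun e => if e.2 = 0 then diagSU2 φ else 1) vA) (ρ 1 vB) - G (ρ (fun e => if e.2 = 0 then diagSU2 φ else 1) vA) (ρ 1 vA) := fun φ => by
    rw [← hΔ φ, hAB φ, hAA φ, hprof]; ring
  have h0 := key 0
  have hπ := key Real.pi
  simp only [path_zero] at h0
  rw [hρ, Real.cos_pi, Real.sin_pi] at hπ
  rw [Real.cos_zero, Real.sin_zero] at h0
  linarith

/-- ★★★ **FROZEN FRAME (R26 sharpened to the abelian × transverse family)**: no `F, G` with `tc(Ψ(w_φ,v),Ψ(w_φ',v')) = F(w_φ,w_φ'; |v|², |v'|²) + G(v, v')`.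
[cite: Luscher1983, §3] -/
theorem not_separable_abelian_transverse (hL : 2 ≤ L) :
    ¬ ∃ (F : GaugeConfig 3 1 SU2 → GaugeConfig 3 1 SU2 → (Edge 3 L → ℝ) → (Edge 3 L → ℝ) → ℝ)
        (G : (Edge 3 L → Fin 3 → ℝ) → (Edge 3 L → Fin 3 → ℝ) → ℝ),
        ∀ (φ φ' : ℝ) (v v' : Edge 3 L → Fin 3 → ℝ), v ∈ capBalancedSet L → v' ∈ capBalancedSet L →
          (∀ e : Edge 3 L, e.2 = 0 → v e 0 = 0) → (∀ e : Edge 3 L, e.2 = 0 → v' e 0 = 0) →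
          timeCoupling su2Rep (orthoTube L (fun e => if e.2 = 0 then diagSU2 φ else 1) v) (orthoTube L (fun e => if e.2 = 0 then diagSU2 φ' else 1) v') =
            F (fun e => if e.2 = 0 then diagSU2 φ else 1) (fun e => if e.2 = 0 then diagSU2 φ' else 1) (fun e => ∑ a, v e a ^ 2) (fun e => ∑ a, v' e a ^ 2) +
              G v v' :=
  not_separable_of_frame_period hL (fun _ v => v) rfl

/-- `Ad` does not see the centre: `Ad(diagSU2 π) = Ad(−1) = 1 = Ad(diagSU2 0)`. [cite: BrockerTomDieck1985, I (1.10)] -/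
theorem adRot_diagSU2_pi : adRot (diagSU2 Real.pi) = adRot (diagSU2 0) := by
  rw [adRot_diagSU2, adRot_diagSU2, mul_zero, chargedRot_zero]
  ext i j
  fin_cases i <;> fin_cases j <;> simp [chargedRot, Real.cos_two_pi, Real.sin_two_pi]

/-- The adjoint images of the slow links along the path agree at `φ = π` and `φ = 0`. [folklore] -/
theorem adjointImages_pi_eq_zero :
    (fun k : Fin 3 => adRot ((fun e : Edge 3 1 => if e.2 = 0 then diagSU2 Real.pi else (1 : SU2)) (0, k))) =
      fun k : Fin 3 => adRot ((fun e : Edge 3 1 => if e.2 = 0 then diagSU2 0 else (1 : SU2)) (0, k)) := by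
  funext k
  by_cases hk : k = 0
  · simp only [hk, if_true, adRot_diagSU2_pi]
  · simp only [hk, if_false]

/-- ★★★ **NO FRAME THAT FACTORS THROUGH THE ADJOINT IMAGES `(Ad(u_k))_k`** — any «LAB rotation of the slow link», `Ad(u)`, `Ad(u)⁻¹ = Ad(u)ᵀ`, or any function `ρ̃` of
them, linear or not: no `F, G` with `tc(Ψ(w_φ,v),Ψ(w_φ',v')) = F(w_φ,w_φ'; |v|², |v'|²) + G(ρ̃(Ad w_φ) v, ρ̃(Ad w_φ') v')` on the abelian × transverse family.  The frame that
works (§2) is spinorial. [cite: Luscher1983, §3] -/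
theorem not_separable_adjointFrame (hL : 2 ≤ L) (ρt : (Fin 3 → Matrix (Fin 3) (Fin 3) ℝ) → (Edge 3 L → Fin 3 → ℝ) → (Edge 3 L → Fin 3 → ℝ)) :
    ¬ ∃ (F : GaugeConfig 3 1 SU2 → GaugeConfig 3 1 SU2 → (Edge 3 L → ℝ) → (Edge 3 L → ℝ) → ℝ)
        (G : (Edge 3 L → Fin 3 → ℝ) → (Edge 3 L → Fin 3 → ℝ) → ℝ),
        ∀ (φ φ' : ℝ) (v v' : Edge 3 L → Fin 3 → ℝ), v ∈ capBalancedSet L → v' ∈ capBalancedSet L →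
          (∀ e : Edge 3 L, e.2 = 0 → v e 0 = 0) → (∀ e : Edge 3 L, e.2 = 0 → v' e 0 = 0) →
          timeCoupling su2Rep (orthoTube L (fun e => if e.2 = 0 then diagSU2 φ else 1) v) (orthoTube L (fun e => if e.2 = 0 then diagSU2 φ' else 1) v') =
            F (fun e => if e.2 = 0 then diagSU2 φ else 1) (fun e => if e.2 = 0 then diagSU2 φ' else 1) (fun e => ∑ a, v e a ^ 2) (fun e => ∑ a, v' e a ^ 2) +
              G (ρt (fun k => adRot ((fun e : Edge 3 1 => if e.2 = 0 then diagSU2 φ else (1 : SU2)) (0, k))) v)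
                (ρt (fun k => adRot ((fun e : Edge 3 1 => if e.2 = 0 then diagSU2 φ' else (1 : SU2)) (0, k))) v') :=
  not_separable_of_frame_period hL (fun u => ρt fun k => adRot (u (0, k))) (congrArg ρt adjointImages_pi_eq_zero)

/-- ★★★ **In lane A's vocabulary: the FULL-ANGLE colour frame `colourRotate (u_k)_k` (the adjoint rotation by the slow links themselves) is refuted** on the abelian ×
transverse family; contrast `timeCoupling_abelian_transverse` (the half-angle frame `colourRotate (P(−φ/2), 1, 1)` is exact there). [cite: Luscher1983, §3] -/
theorem not_separable_colourRotate_slowLink (hL : 2 ≤ L) :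
    ¬ ∃ (F : GaugeConfig 3 1 SU2 → GaugeConfig 3 1 SU2 → (Edge 3 L → ℝ) → (Edge 3 L → ℝ) → ℝ)
        (G : (Edge 3 L → Fin 3 → ℝ) → (Edge 3 L → Fin 3 → ℝ) → ℝ),
        ∀ (φ φ' : ℝ) (v v' : Edge 3 L → Fin 3 → ℝ), v ∈ capBalancedSet L → v' ∈ capBalancedSet L →
          (∀ e : Edge 3 L, e.2 = 0 → v e 0 = 0) → (∀ e : Edge 3 L, e.2 = 0 → v' e 0 = 0) →
          timeCoupling su2Rep (orthoTube L (fun e => if e.2 = 0 then diagSU2 φ else 1) v) (orthoTube L (fun e => if e.2 = 0 then diagSU2 φ' else 1) v') =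
            F (fun e => if e.2 = 0 then diagSU2 φ else 1) (fun e => if e.2 = 0 then diagSU2 φ' else 1) (fun e => ∑ a, v e a ^ 2) (fun e => ∑ a, v' e a ^ 2) +
              G (colourRotate L (fun k => (fun e : Edge 3 1 => if e.2 = 0 then diagSU2 φ else (1 : SU2)) (0, k)) v)
                (colourRotate L (fun k => (fun e : Edge 3 1 => if e.2 = 0 then diagSU2 φ' else (1 : SU2)) (0, k)) v') := by
  refine not_separable_of_frame_period hL (fun u => colourRotate L fun k => u (0, k)) ?_
  funext v e
  simp only [colourRotate]
  by_cases hk : e.2 = 0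
  · simp only [hk, if_true, adRot_diagSU2_pi]
  · simp only [hk, if_false]

end Summit.QuantumFields.YangMills.Theorems.TwistedTraceScaling.Negative.R28

end
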